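import Mathlib
import Literature.Analysis.FluidPDE.SelfSimilarEulerProfile
import Literature.Analysis.FluidPDE.NormalisedPressure
import Summits.NavierStokesRegularity.NavierStokesRegularity.Theorems.EulerZoomLiouvillePowerGaugeEulerLiouvillePressureBudgetSeam
import HarnessLib

/-!
# Crux `EulerZoomLiouville.PowerGaugeEulerLiouville` (stmt-NavierStokesRegularity-19832), nsreg-p2 ROUND-58 plate t60-ΠLOG:
# THE ΠLOG ASSEMBLY (near-field log bound + scale representation ⇒ the pressure budget with a logarithm, modulo constants)

Seat ns-ezl-w3 g9 (`--supports stmt-NavierStokesRegularity-19832 --as helper`).  Text = nsreg-p2 g45's `NsregP2.R58b.PiLogAssembly ρ`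
(`r58/Sketch58b.lean` sha16 16d8b95ef8e183bb: `NearFieldLog → ScaleRepresentation ρ → PiLog ρ`) with the three `def`s δ-unfolded VERBATIM and
the target budget spelled by the TREE's name `PressureSeam.PressureBudgetLogMod` (p715977; Sketch58b's copy is the same text), so the plate closes
BY NAME: `example (ρ) : NsregP2.R58b.PiLogAssembly ρ := PressureSeam.piLogAssembly ρ`.

Content (S, real analysis only — «the glue a hand proves first»):
* `PressureSeam.mul_one_add_posLog_div_mono` — the monotonicity of `m ↦ m·(1 + log⁺(K/m))` on `[0, ∞)` for `K ≥ 0` (three cases: `K ≤ m₁`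
  trivially; `m₁ < K ≤ m₂` by `log t ≤ t − 1`; `m₁ ≤ m₂ < K` by `log(m₂/m₁) ≤ m₂/m₁ − 1`), junk-safe at `m = 0` (`K/0 = 0`, `log⁺ 0 = 0`);
* `PressureSeam.posLog_scale_ratio_le` — `log⁺(R²·(D₁R^{1−ρ})/(D₁R^{1−2ρ})) ≤ |2+ρ|·log R` for `R ≥ 1`, `D₁ > 0`;
* ★ `PressureSeam.piLogAssembly ρ` — for every `ρ`: PIECE (1′) `NearFieldLog` (`∫_{B_R}|p̃[w]| ≤ C·m·(1 + log⁺(R²e/m))`, `m = ∫|w|²`, `e = ∫|∇w|²`,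
  all `w ∈ C²_c`) and PIECE (2)+(3) `ScaleRepresentation ρ` (`P = c_R + p̃[w_R] + h_R` on `B_R` with `∫|w_R|² ≤ DR^{1−2ρ}`, `∫|∇w_R|² ≤ DR^{1−ρ}`,
  `∫_{B_R}|h_R| ≤ DR^{1−2ρ}`) imply `PiLog ρ` (`PressureBudgetLogMod ρ P` for every profile with the E-budget and the velocity budget), with the
  constant `D′ = max D 1 · (C(1 + |2+ρ|) + 1)`: triangle inequality on `B_R`, monotonicity in `m` up to `m = max D 1 · R^{1−2ρ}`, then
  `log⁺(R^{2+ρ}) ≤ |2+ρ| log R`.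

HONEST FRAMING: instrument glue about HYPOTHETICAL profiles (the two analytic pieces are hypotheses here, to be landed by their own hands); nothing
about the crux E (19832 OPEN) or NS regularity is proved; not E.  MODEL lattice only.
-/

noncomputable section

-- flat `Theorems/<Route><Decl>…` files of one crux share the namespace of the crux (tree convention)
set_option linter.dupNamespace false

open MeasureTheory Metric Filter Topology
open scoped ENNReal NNReal

namespace Summit.NavierStokesRegularity.NavierStokesRegularity.Theorems.PowerGaugeEulerLiouville.PressureSeam

open Literature.Analysis.FluidPDE

/-- **Monotonicity of `m ↦ m·(1 + log⁺(K/m))` on `[0, ∞)`** (`K ≥ 0`): for `0 ≤ m₁ ≤ m₂`,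
`m₁(1 + log⁺(K/m₁)) ≤ m₂(1 + log⁺(K/m₂))`.  Elementary (`log t ≤ t − 1` twice); junk-safe at `m₁ = 0`. -/
theorem mul_one_add_posLog_div_mono {K m₁ m₂ : ℝ} (hK : 0 ≤ K) (hm₁ : 0 ≤ m₁) (h : m₁ ≤ m₂) :
    m₁ * (1 + Real.posLog (K / m₁)) ≤ m₂ * (1 + Real.posLog (K / m₂)) := by
  have hm₂ : 0 ≤ m₂ := hm₁.trans h
  have hR2 : m₂ ≤ m₂ * (1 + Real.posLog (K / m₂)) :=
    le_mul_of_one_le_right hm₂ (by linarith [Real.posLog_nonneg (x := K / m₂)])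
  rcases hm₁.eq_or_lt with hz | hm₁pos
  · rw [← hz, zero_mul]
    exact hm₂.trans hR2
  have hm₂pos : 0 < m₂ := hm₁pos.trans_le h
  rcases le_or_gt K m₁ with hKm₁ | hKm₁
  · -- `K ≤ m₁`: the logarithm on the left vanishes
    have h1 : Real.posLog (K / m₁) = 0 := (Real.posLog_eq_zero_iff _).2 (by
      rw [abs_of_nonneg (div_nonneg hK hm₁)]
      exact div_le_one_of_le₀ hKm₁ hm₁)
    rw [h1, add_zero, mul_one]
    exact h.trans hR2
  · -- `m₁ < K`: the left logarithm is a genuine `log`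
    have hKpos : 0 < K := hm₁pos.trans hKm₁
    have h1 : Real.posLog (K / m₁) = Real.log (K / m₁) := Real.posLog_eq_log (by
      rw [abs_of_nonneg (div_nonneg hK hm₁)]
      exact (one_le_div hm₁pos).2 hKm₁.le)
    rw [h1]
    rcases le_or_gt K m₂ with hKm₂ | hKm₂
    · -- `m₁ < K ≤ m₂`: `m₁(1 + log(K/m₁)) ≤ K ≤ m₂`
      have hlog : Real.log (K / m₁) ≤ K / m₁ - 1 := Real.log_le_sub_one_of_pos (by positivity)
      calc m₁ * (1 + Real.log (K / m₁)) ≤ m₁ * (K / m₁) := mul_le_mul_of_nonneg_left (by linarith) hm₁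
        _ = K := by field_simp
        _ ≤ m₂ := hKm₂
        _ ≤ m₂ * (1 + Real.posLog (K / m₂)) := hR2
    · -- `m₁ ≤ m₂ < K`: split `log(K/m₁) = log(K/m₂) + log(m₂/m₁)` and use `log s ≤ s − 1`
      have h2 : Real.posLog (K / m₂) = Real.log (K / m₂) := Real.posLog_eq_log (by
        rw [abs_of_nonneg (div_nonneg hK hm₂)]
        exact (one_le_div hm₂pos).2 hKm₂.le)
      rw [h2]
      have hsplit : Real.log (K / m₁) = Real.log (K / m₂) + Real.log (m₂ / m₁) := by
        rw [← Real.log_mul (by positivity) (by positivity)]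
        congr 1
        field_simp
      rw [hsplit]
      have hLb : 0 ≤ Real.log (K / m₂) := Real.log_nonneg ((one_le_div hm₂pos).2 hKm₂.le)
      have hLs : Real.log (m₂ / m₁) ≤ m₂ / m₁ - 1 := Real.log_le_sub_one_of_pos (by positivity)
      have h3 : m₁ * Real.log (m₂ / m₁) ≤ m₂ - m₁ := by
        calc m₁ * Real.log (m₂ / m₁) ≤ m₁ * (m₂ / m₁ - 1) := mul_le_mul_of_nonneg_left hLs hm₁
          _ = m₂ - m₁ := by field_simp
      nlinarith [mul_le_mul_of_nonneg_right h hLb]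

/-- The logarithm of the scale ratio: for `R ≥ 1`, `D₁ > 0`,
`log⁺(R²·(D₁R^{1−ρ})/(D₁R^{1−2ρ})) ≤ |2+ρ|·log R` (the ratio is `R^{2+ρ}`). -/
theorem posLog_scale_ratio_le {ρ R D₁ : ℝ} (hR : 1 ≤ R) (hD₁ : 0 < D₁) :
    Real.posLog (R ^ 2 * (D₁ * R ^ (1 - ρ)) / (D₁ * R ^ (1 - 2 * ρ))) ≤ |2 + ρ| * Real.log R := by
  have hR0 : 0 < R := by linarith
  have hlogR : 0 ≤ Real.log R := Real.log_nonneg hR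
  have ha : 0 < R ^ (1 - ρ) := Real.rpow_pos_of_pos hR0 _
  have hb : 0 < R ^ (1 - 2 * ρ) := Real.rpow_pos_of_pos hR0 _
  have hX : Real.log (R ^ 2 * (D₁ * R ^ (1 - ρ)) / (D₁ * R ^ (1 - 2 * ρ))) = (2 + ρ) * Real.log R := by
    rw [Real.log_div (by positivity) (by positivity), Real.log_mul (by positivity) (by positivity),
      Real.log_mul hD₁.ne' ha.ne', Real.log_mul hD₁.ne' hb.ne', Real.log_pow,
      Real.log_rpow hR0, Real.log_rpow hR0]
    push_cast
    ring
  rw [Real.posLog_apply, hX]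
  refine max_le (by positivity) ?_
  exact mul_le_mul_of_nonneg_right (le_abs_self _) hlogR

/-- ★ **t60-ΠLOG, THE ASSEMBLY** (= `NsregP2.R58b.PiLogAssembly ρ` VERBATIM, defs δ-unfolded; every `ρ`): the near-field log bound
(PIECE (1′) `NearFieldLog`) and the scale representation modulo constants (PIECE (2)+(3) `ScaleRepresentation ρ`) imply the pressure
budget with a logarithm modulo constants (`PressureSeam.PressureBudgetLogMod ρ P`) for every `C²` self-similar Euler profile `(V, P)`
(`γ = 1/(2+ρ)`, centre `0`) with the E-budget and the velocity budget.  Constant: `max D 1 · (C(1+|2+ρ|) + 1)`.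
[nsreg-p2 R58 SEEDS-R58 S2, `r58/Sketch58b.lean` §2 `PiLogAssembly`] -/
theorem piLogAssembly (ρ : ℝ)
    (h1 : ∃ C : ℝ, 0 < C ∧ ∀ R : ℝ, 1 ≤ R → ∀ w : EuclideanSpace ℝ (Fin 3) → EuclideanSpace ℝ (Fin 3),
      ContDiff ℝ 2 w → HasCompactSupport w →
        IntegrableOn (normalisedPressure w) (ball (0 : EuclideanSpace ℝ (Fin 3)) R) volume ∧
        ∫ y in ball (0 : EuclideanSpace ℝ (Fin 3)) R, |normalisedPressure w y| ≤
          C * (∫ y, ‖w y‖ ^ 2) *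
            (1 + Real.posLog (R ^ 2 * (∫ y, ‖fderiv ℝ w y‖ ^ 2) / ∫ y, ‖w y‖ ^ 2)))
    (h23 : ∀ (V : EuclideanSpace ℝ (Fin 3) → EuclideanSpace ℝ (Fin 3)) (P : EuclideanSpace ℝ (Fin 3) → ℝ),
      IsSelfSimilarEulerProfile (1 / (2 + ρ)) 0 V P →
        (∫⁻ y, ‖fderiv ℝ V y‖ₑ ^ 2 * ENNReal.ofReal (‖y‖ ^ (ρ - 1))) ≠ ⊤ →
        (∃ A : ℝ, ∀ R : ℝ, 1 ≤ R →
          ∫ y in ball (0 : EuclideanSpace ℝ (Fin 3)) R, ‖V y‖ ^ 2 ≤ A * R ^ (1 - 2 * ρ)) →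
        ∃ D : ℝ, ∀ R : ℝ, 1 ≤ R →
          ∃ (c : ℝ) (w : EuclideanSpace ℝ (Fin 3) → EuclideanSpace ℝ (Fin 3)) (h : EuclideanSpace ℝ (Fin 3) → ℝ),
            ContDiff ℝ 2 w ∧ HasCompactSupport w ∧
            (∀ y ∈ ball (0 : EuclideanSpace ℝ (Fin 3)) (3 * R / 2), w y = V y) ∧
            (∫ y, ‖w y‖ ^ 2) ≤ D * R ^ (1 - 2 * ρ) ∧
            (∫ y, ‖fderiv ℝ w y‖ ^ 2) ≤ D * R ^ (1 - ρ) ∧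
            IntegrableOn h (ball (0 : EuclideanSpace ℝ (Fin 3)) R) volume ∧
            (∫ y in ball (0 : EuclideanSpace ℝ (Fin 3)) R, |h y|) ≤ D * R ^ (1 - 2 * ρ) ∧
            ∀ y ∈ ball (0 : EuclideanSpace ℝ (Fin 3)) R, P y = c + normalisedPressure w y + h y) :
    ∀ (V : EuclideanSpace ℝ (Fin 3) → EuclideanSpace ℝ (Fin 3)) (P : EuclideanSpace ℝ (Fin 3) → ℝ),
      IsSelfSimilarEulerProfile (1 / (2 + ρ)) 0 V P →
        (∫⁻ y, ‖fderiv ℝ V y‖ₑ ^ 2 * ENNReal.ofReal (‖y‖ ^ (ρ - 1))) ≠ ⊤ →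
        (∃ A : ℝ, ∀ R : ℝ, 1 ≤ R →
          ∫ y in ball (0 : EuclideanSpace ℝ (Fin 3)) R, ‖V y‖ ^ 2 ≤ A * R ^ (1 - 2 * ρ)) →
        PressureBudgetLogMod ρ P := by
  intro V P hprof hE hA
  obtain ⟨C, hC0, hC⟩ := h1
  obtain ⟨D, hD⟩ := h23 V P hprof hE hA
  set D₁ : ℝ := max D 1 with hD₁_def
  have hDD₁ : D ≤ D₁ := le_max_left _ _
  have hD₁1 : 1 ≤ D₁ := le_max_right _ _
  have hD₁0 : 0 < D₁ := one_pos.trans_le hD₁1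
  refine ⟨D₁ * (C * (1 + |2 + ρ|) + 1), fun R hR => ?_⟩
  have hR0 : 0 < R := by linarith
  have hlogR : 0 ≤ Real.log R := Real.log_nonneg hR
  obtain ⟨c, w, h, hw2, hwc, -, hm, he, hhint, hhL1, hrep⟩ := hD R hR
  obtain ⟨hpint, hpL1⟩ := hC R hR w hw2 hwc
  refine ⟨c, ?_⟩
  -- Step 1: the triangle inequality on `B_R`
  have step1 : ∫ y in ball (0 : EuclideanSpace ℝ (Fin 3)) R, |P y - c| ≤
      (∫ y in ball (0 : EuclideanSpace ℝ (Fin 3)) R, |normalisedPressure w y|) +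
        ∫ y in ball (0 : EuclideanSpace ℝ (Fin 3)) R, |h y| := by
    rw [← integral_add hpint.abs hhint.abs]
    refine integral_mono_of_nonneg (ae_of_all _ fun y => abs_nonneg _) (hpint.abs.add hhint.abs) ?_
    rw [Filter.EventuallyLE, ae_restrict_iff' measurableSet_ball]
    refine ae_of_all _ fun y hy => ?_
    rw [hrep y hy, show c + normalisedPressure w y + h y - c = normalisedPressure w y + h y by ring]
    exact abs_add_le _ _
  -- Step 2: the near field — monotonicity in `m = ∫|w|²` up to `D₁ R^{1−2ρ}`, then the log of the scale ratio
  set m : ℝ := ∫ y, ‖w y‖ ^ 2 with hm_def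
  set e : ℝ := ∫ y, ‖fderiv ℝ w y‖ ^ 2 with he_def
  have hm0 : 0 ≤ m := integral_nonneg fun _ => by positivity
  have he0 : 0 ≤ e := integral_nonneg fun _ => by positivity
  have hρ1 : 0 < R ^ (1 - 2 * ρ) := Real.rpow_pos_of_pos hR0 _
  have hρ2 : 0 < R ^ (1 - ρ) := Real.rpow_pos_of_pos hR0 _
  set M : ℝ := D₁ * R ^ (1 - 2 * ρ) with hM_def
  have hM0 : 0 < M := mul_pos hD₁0 hρ1
  have hmM : m ≤ M := hm.trans (mul_le_mul_of_nonneg_right hDD₁ hρ1.le)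
  have heM : e ≤ D₁ * R ^ (1 - ρ) := he.trans (mul_le_mul_of_nonneg_right hDD₁ hρ2.le)
  have key1 : m * (1 + Real.posLog (R ^ 2 * e / m)) ≤ M * (1 + Real.posLog (R ^ 2 * e / M)) :=
    mul_one_add_posLog_div_mono (by positivity) hm0 hmM
  have key2 : Real.posLog (R ^ 2 * e / M) ≤ |2 + ρ| * Real.log R := by
    refine le_trans (Real.posLog_le_posLog (by positivity) ?_) (posLog_scale_ratio_le (ρ := ρ) hR hD₁0)
    exact div_le_div_of_nonneg_right (mul_le_mul_of_nonneg_left heM (by positivity)) hM0.le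
  have step2 : ∫ y in ball (0 : EuclideanSpace ℝ (Fin 3)) R, |normalisedPressure w y| ≤
      C * M * (1 + |2 + ρ|) * (1 + Real.log R) := by
    calc ∫ y in ball (0 : EuclideanSpace ℝ (Fin 3)) R, |normalisedPressure w y|
        ≤ C * m * (1 + Real.posLog (R ^ 2 * e / m)) := hpL1
      _ = C * (m * (1 + Real.posLog (R ^ 2 * e / m))) := by ring
      _ ≤ C * (M * (1 + |2 + ρ| * Real.log R)) := by
          refine mul_le_mul_of_nonneg_left (key1.trans ?_) hC0.le
          exact mul_le_mul_of_nonneg_left (by linarith) hM0.le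
      _ ≤ C * (M * ((1 + |2 + ρ|) * (1 + Real.log R))) := by
          refine mul_le_mul_of_nonneg_left (mul_le_mul_of_nonneg_left ?_ hM0.le) hC0.le
          nlinarith [abs_nonneg (2 + ρ), hlogR]
      _ = C * M * (1 + |2 + ρ|) * (1 + Real.log R) := by ring
  -- Step 3: the remainder, no logarithm
  have step3 : ∫ y in ball (0 : EuclideanSpace ℝ (Fin 3)) R, |h y| ≤ M * (1 + Real.log R) := by
    calc ∫ y in ball (0 : EuclideanSpace ℝ (Fin 3)) R, |h y| ≤ D * R ^ (1 - 2 * ρ) := hhL1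
      _ ≤ M := mul_le_mul_of_nonneg_right hDD₁ hρ1.le
      _ ≤ M * (1 + Real.log R) := le_mul_of_one_le_right hM0.le (by linarith)
  -- Assembly
  calc ∫ y in ball (0 : EuclideanSpace ℝ (Fin 3)) R, |P y - c|
      ≤ C * M * (1 + |2 + ρ|) * (1 + Real.log R) + M * (1 + Real.log R) := step1.trans (add_le_add step2 step3)
    _ = D₁ * (C * (1 + |2 + ρ|) + 1) * (R ^ (1 - 2 * ρ) * (1 + Real.log R)) := by rw [hM_def]; ring

end Summit.NavierStokesRegularity.NavierStokesRegularity.Theorems.PowerGaugeEulerLiouville.PressureSeam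

end
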